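import Summits.CriticalPhenomena.PercolationContinuityZ3.Theses.PercLoopDislocationCovers
import Summits.CriticalPhenomena.PercolationContinuityZ3.Theorems.PercLoopDislocationCoversCoverSubcritTransferBounds
import Literature.Probability.Percolation.CorrelationLengthDKTProofs
import Literature.Probability.Percolation.ContinuityCriterion
import Literature.Probability.Percolation.InfraredBoundTriangle
import HarnessLib

/-!
# `PercLoopDislocationCovers.CoverSubcritTransfer` (stmt-CriticalPhenomena-13952): the cover is subcritical past the criterion

RSW3 lane (lead, gen 31).  CLOSES item `stmt-CriticalPhenomena-13952` of route `CriticalPhenomena/PercLoopDislocationCovers`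
(support): there is `C₀` (here `8192`) such that for `s ≥ 2`, `L ≥ 1` with `C₀ L (log₂ L + 1) ≤ s`, every `p < p_c(ℤ³)`
satisfying the finite-size criterion `(2L+1)³ P_p(0 ↔ ∂Λ_L) ≤ 1/2` gives `θ_{G_s}(õ, p) = 0` on the loop-dislocated cover
`G_s = dislocationLoopCover s`.

Proof.  (1) `phi_box_le`: the criterion makes the Duminil-Copin–Tassion functional small, `φ_p(Λ_L) ≤ 3/5` (each boundary
term is `≤ P_p(0 ↔ ∂Λ_L)`, and the boundary pairs `(x, y)` inject into `Λ_{L+1} ∖ Λ_L` via `y`; `L = 1, 2` use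
`p^L ≤ P_p(0 ↔ ∂Λ_L)`), so `τ_p(0, v) ≤ (3/5)^{⌊(‖v‖∞ − 1)/(L+1)⌋}` (`real_siteToBoundary_le_phi_pow_div`).  (2) `kernel_bound`:
sites `z`, `u` over distinct patch labels `P ≠ P′` are `≥ t·max_j |P′_j − P_j|` apart (`…Patches`, `t = ⌊s/2⌋`), whence
`τ_p(z, u) ≤ ν^{2‖P′−P‖₁}` with `ν = (3/5)^{n}`, `n = ⌊⌊(t−1)/(L+1)⌋/6⌋ ≥ 256 (log₂ L + 1)`.  (3) `numeric_bound`: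
`512 t⁴ ν < 1` (as `t ≤ 6(n+1)(L+1)`, `L + 1 ≤ 2^{log₂ L + 1}`, `(n+1)⁴(3/4)^n ≤ 1000`, `(4/5)^{256} ≤ 2^{-64}`).
(4) `theta_eq_zero_of_kernel_bound` of `…Bounds` (Aizenman–Newman cluster-of-clusters on the cover, BK, Borel–Cantelli) with
`χ(p) < ∞` from sharpness (`summable_tau_of_lt_criticalProb`).  Continuity-free.

Main result: `coverSubcritTransfer_proof`.  No definitions, no sorries.  References: M. Aizenman, C. M. Newman, J. Stat. Phys.
36 (1984) §4 [AizenmanNewman1984]; H. Duminil-Copin, V. Tassion, Enseign. Math. 62 (2016) §2.1 [DuminilCopinTassionEM2016];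
G. Grimmett, *Percolation* (1999), §2.3, §5.2 [GrimmettPercolation1999]; R. Lyons, Y. Peres (2016), Thm. 6.47 [LyonsPeres2016].
-/

noncomputable section

namespace Summit.CriticalPhenomena.PercolationContinuityZ3.Theorems

namespace CoverSubcritTransfer

open MeasureTheory Finset Literature.Probability.LatticeModels Literature.Probability.Percolation
open Literature.Probability.Percolation.DislocationLoopCover
open scoped ENNReal

/-! ### The finite-size criterion makes `φ_p(Λ_L)` small -/

/-- A boundary pair `(x, y)` of `Λ_L` (`x ∈ Λ_L ∼ y ∉ Λ_L`) is determined by `y`, and `y ∈ Λ_{L+1}`. [folklore] -/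
theorem boundaryPair_unique {L : ℕ} {x x' y : Site 3} (hx : x ∈ box 3 L) (hx' : x' ∈ box 3 L) (hy : y ∉ box 3 L)
    (hxy : (zdGraph 3).Adj x y) (hx'y : (zdGraph 3).Adj x' y) : x = x' ∧ y ∈ box 3 (L + 1) := by
  rw [mem_box] at hx hx' hy
  obtain ⟨j, hj⟩ := not_forall.1 hy
  obtain ⟨i, hi⟩ := (zdGraph_adj_iff x y).1 hxy
  obtain ⟨i', hi'⟩ := (zdGraph_adj_iff x' y).1 hx'y
  have hc : ∀ (a b : Site 3) (j k : Fin 3), (b = a + Pi.single j 1 ∨ a = b + Pi.single j 1) →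
      (k ≠ j → b k = a k) ∧ (b j = a j + 1 ∨ b j = a j - 1) := by
    intro a b j k h
    rcases h with h | h
    · refine ⟨fun hk => ?_, Or.inl ?_⟩
      · rw [h, Pi.add_apply, Pi.single_eq_of_ne hk, add_zero]
      · rw [h, Pi.add_apply, Pi.single_eq_same]
    · refine ⟨fun hk => ?_, Or.inr ?_⟩
      · rw [h, Pi.add_apply, Pi.single_eq_of_ne hk, add_zero]
      · rw [h, Pi.add_apply, Pi.single_eq_same]; ring
  -- the bad coordinate of `y` must be `i` and `i'`
  have hji : j = i := by
    by_contra hne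
    have := (hc x y i j hi).1 hne
    have h1 := hx j
    rw [← this] at h1
    omega
  have hji' : j = i' := by
    by_contra hne
    have := (hc x' y i' j hi').1 hne
    have h1 := hx' j
    rw [← this] at h1
    omega
  subst hji
  refine ⟨?_, ?_⟩
  · funext k
    by_cases hk : k = j
    · subst hk
      have h1 := (hc x y k k hi).2
      have h2 := (hc x' y i' k hi').2
      have h3 := hx k
      have h4 := hx' k
      rw [← hji'] at h2
      omega
    · have h1 := (hc x y j k hi).1 hk
      have h2 := (hc x' y i' k hi').1 (hji' ▸ hk)
      rw [← h1, ← h2]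
  · rw [mem_box]
    intro k
    by_cases hk : k = j
    · subst hk
      have h1 := (hc x y k k hi).2
      have h3 := hx k
      push_cast
      omega
    · have h1 := (hc x y j k hi).1 hk
      have h3 := hx k
      rw [h1]
      push_cast
      omega

/-- **The number of boundary pairs of `Λ_L` is at most `|Λ_{L+1} ∖ Λ_L| = (2L+3)³ − (2L+1)³`.** [folklore] -/
theorem card_boundaryPairs_le (L : ℕ) :
    (∑ x ∈ box 3 L, (((zdGraph 3).neighborFinset x).filter (· ∉ box 3 L)).card : ℝ) ≤
      ((2 * L + 3) ^ 3 : ℝ) - (2 * L + 1) ^ 3 := by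
  classical
  have h1 : ∑ x ∈ box 3 L, (((zdGraph 3).neighborFinset x).filter (· ∉ box 3 L)).card =
      ((box 3 L).sigma fun x => ((zdGraph 3).neighborFinset x).filter (· ∉ box 3 L)).card :=
    (Finset.card_sigma _ _).symm
  have h2 : ((box 3 L).sigma fun x => ((zdGraph 3).neighborFinset x).filter (· ∉ box 3 L)).card ≤
      (box 3 (L + 1) \ box 3 L).card := by
    refine Finset.card_le_card_of_injOn (fun q => q.2) (fun q hq => ?_) (fun q hq q' hq' h => ?_)
    · rw [Finset.mem_coe, Finset.mem_sigma, Finset.mem_filter, SimpleGraph.mem_neighborFinset] at hq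
      rw [Finset.mem_coe, Finset.mem_sdiff]
      exact ⟨(boundaryPair_unique hq.1 hq.1 hq.2.2 hq.2.1 hq.2.1).2, hq.2.2⟩
    · rw [Finset.mem_coe, Finset.mem_sigma, Finset.mem_filter, SimpleGraph.mem_neighborFinset] at hq hq'
      simp only at h
      obtain ⟨a, b⟩ := q
      obtain ⟨a', b'⟩ := q'
      simp only at h hq hq'
      subst h
      exact Sigma.ext (boundaryPair_unique hq.1 hq'.1 hq.2.2 hq.2.1 hq'.2.1).1 (heq_of_eq rfl)
  have h3 : (box 3 (L + 1) \ box 3 L).card = (2 * (L + 1) + 1) ^ 3 - (2 * L + 1) ^ 3 := by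
    rw [Finset.card_sdiff_of_subset (box_mono 3 (Nat.le_succ L)), card_box, card_box]
  have h4 : (2 * L + 1) ^ 3 ≤ (2 * (L + 1) + 1) ^ 3 := Nat.pow_le_pow_left (by omega) 3
  have h5' : ∑ x ∈ box 3 L, (((zdGraph 3).neighborFinset x).filter (· ∉ box 3 L)).card ≤
      (2 * (L + 1) + 1) ^ 3 - (2 * L + 1) ^ 3 := by
    rw [h1, ← h3]; exact h2
  have h5 : (∑ x ∈ box 3 L, (((zdGraph 3).neighborFinset x).filter (· ∉ box 3 L)).card : ℝ) ≤
      (((2 * (L + 1) + 1) ^ 3 - (2 * L + 1) ^ 3 : ℕ) : ℝ) := by exact_mod_cast h5'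
  refine h5.trans (le_of_eq ?_)
  rw [Nat.cast_sub h4]
  push_cast
  ring

/-- **The criterion makes `φ_p(Λ_L)` small**: if `(2L+1)³ P_p(0 ↔ ∂Λ_L) ≤ 1/2` (`L ≥ 1`) then `φ_p(Λ_L) ≤ 3/5`.
[cite: DuminilCopinTassionEM2016, §2.1] -/
theorem phi_box_le (p : unitInterval) {L : ℕ} (hL : 1 ≤ L)
    (hcrit : ((2 * L + 1) ^ 3 : ℝ) * (bondPercolation (zdGraph 3) p).real (siteToBoundary 3 L) ≤ 1 / 2) :
    DCT16.phi p (box 3 L) ≤ 3 / 5 := by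
  classical
  set g : ℝ := (bondPercolation (zdGraph 3) p).real (siteToBoundary 3 L) with hg
  have hg0 : 0 ≤ g := measureReal_nonneg
  have hp0 : 0 ≤ (p : ℝ) := p.2.1
  have hp1 : (p : ℝ) ≤ 1 := p.2.2
  -- each boundary term is at most `g`
  have hterm : ∀ x ∈ box 3 L, ∀ y ∈ ((zdGraph 3).neighborFinset x).filter (· ∉ box 3 L),
      (bondPercolation (zdGraph 3) p).real (openConnIn (↑(box 3 L) : Set (Site 3)) 0 x) ≤ g := by
    intro x hx y hy
    rw [Finset.mem_filter, SimpleGraph.mem_neighborFinset] at hy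
    refine measureReal_mono (fun ω hω => ?_)
    exact ⟨x, mem_innerBoundary_iff.2 ⟨hx, y, hy.2, hy.1⟩, hω⟩
  have hphi : DCT16.phi p (box 3 L) ≤ p * (g * (((2 * L + 3) ^ 3 : ℝ) - (2 * L + 1) ^ 3)) := by
    rw [DCT16.phi_def]
    refine mul_le_mul_of_nonneg_left ?_ hp0
    calc ∑ x ∈ box 3 L, ∑ y ∈ (zdGraph 3).neighborFinset x with y ∉ box 3 L,
          (bondPercolation (zdGraph 3) p).real (openConnIn (↑(box 3 L) : Set (Site 3)) 0 x)
        ≤ ∑ x ∈ box 3 L, ∑ y ∈ (zdGraph 3).neighborFinset x with y ∉ box 3 L, g :=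
          Finset.sum_le_sum fun x hx => Finset.sum_le_sum fun y hy => hterm x hx y hy
      _ = g * ∑ x ∈ box 3 L, ((((zdGraph 3).neighborFinset x).filter (· ∉ box 3 L)).card : ℝ) := by
          rw [Finset.mul_sum]
          refine Finset.sum_congr rfl fun x _ => ?_
          rw [Finset.sum_const, nsmul_eq_mul, mul_comm]
      _ ≤ g * (((2 * L + 3) ^ 3 : ℝ) - (2 * L + 1) ^ 3) :=
          mul_le_mul_of_nonneg_left (by exact_mod_cast card_boundaryPairs_le L) hg0
  have hgL : g * (2 * L + 1) ^ 3 ≤ 1 / 2 := by rw [mul_comm]; exact hcrit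
  have hpL : (p : ℝ) ^ L ≤ g := DKT20.pow_le_real_siteToBoundary (d := 3) (by norm_num) p L
  refine hphi.trans ?_
  rcases Nat.lt_or_ge L 3 with h3 | h3
  · interval_cases L
    · norm_num at hgL hpL ⊢
      nlinarith
    · norm_num at hgL hpL ⊢
      nlinarith [sq_nonneg (p : ℝ)]
  · have hL3 : (3 : ℝ) ≤ L := by exact_mod_cast h3
    have hD : (0 : ℝ) ≤ (2 * L + 3) ^ 3 - (2 * L + 1) ^ 3 := by nlinarith
    calc (p : ℝ) * (g * ((2 * L + 3) ^ 3 - (2 * L + 1) ^ 3)) ≤ 1 * (g * ((2 * L + 3) ^ 3 - (2 * L + 1) ^ 3)) :=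
          mul_le_mul_of_nonneg_right hp1 (mul_nonneg hg0 hD)
      _ ≤ 3 / 5 := by
          rw [one_mul]
          -- `g ≤ 1 / (2 (2L+1)³)` and `5 ((2L+3)³ − (2L+1)³) ≤ 6 (2L+1)³` for `L ≥ 3`
          have hpoly : 5 * ((2 * (L : ℝ) + 3) ^ 3 - (2 * L + 1) ^ 3) ≤ 6 * (2 * L + 1) ^ 3 := by
            nlinarith [mul_nonneg (mul_nonneg (sub_nonneg.2 hL3) (Nat.cast_nonneg L)) (Nat.cast_nonneg L),
              mul_nonneg (sub_nonneg.2 hL3) (Nat.cast_nonneg L)]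
          have hcube : (0 : ℝ) < (2 * L + 1) ^ 3 := by positivity
          nlinarith

/-! ### The kernel bound across distinct patches -/

/-- `(n+1)⁴ (3/4)^n ≤ 1000` for all `n`. [folklore] -/
theorem pow_four_mul_pow_le (n : ℕ) : ((n : ℝ) + 1) ^ 4 * (3 / 4 : ℝ) ^ n ≤ 1000 := by
  rcases Nat.lt_or_ge n 13 with h | h
  · interval_cases n <;> norm_num
  · induction n, h using Nat.le_induction with
    | base => norm_num
    | succ n hn ih =>
        have hn' : (13 : ℝ) ≤ n := by exact_mod_cast hn
        have hstep : 3 * ((n : ℝ) + 1 + 1) ^ 4 ≤ 4 * ((n : ℝ) + 1) ^ 4 := by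
          nlinarith [pow_nonneg (sub_nonneg.2 hn') 2, pow_nonneg (sub_nonneg.2 hn') 3, pow_nonneg (sub_nonneg.2 hn') 4,
            sub_nonneg.2 hn']
        have h34 : (0 : ℝ) ≤ (3 / 4 : ℝ) ^ n := by positivity
        push_cast
        calc ((n : ℝ) + 1 + 1) ^ 4 * (3 / 4 : ℝ) ^ (n + 1) = (3 * ((n : ℝ) + 1 + 1) ^ 4) * (3 / 4 : ℝ) ^ n / 4 := by
              rw [pow_succ]; ring
          _ ≤ (4 * ((n : ℝ) + 1) ^ 4) * (3 / 4 : ℝ) ^ n / 4 := by gcongr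
          _ = ((n : ℝ) + 1) ^ 4 * (3 / 4 : ℝ) ^ n := by ring
          _ ≤ 1000 := ih

/-- **The numeric heart**: `512 t⁴ (3/5)^n < 1` when `t ≤ 6(n+1)(L+1)`, `L + 1 ≤ 2^ℓ` and `256 ℓ ≤ n`, `ℓ ≥ 1`. [folklore] -/
theorem numeric_bound {t n L ℓ : ℕ} (ht : t ≤ 6 * (n + 1) * (L + 1)) (hL : L + 1 ≤ 2 ^ ℓ) (hn : 256 * ℓ ≤ n)
    (hℓ : 1 ≤ ℓ) : (512 : ℝ) * (t : ℝ) ^ 4 * (3 / 5 : ℝ) ^ n < 1 := by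
  have ht' : (t : ℝ) ≤ 6 * ((n : ℝ) + 1) * 2 ^ ℓ := by
    calc (t : ℝ) ≤ ((6 * (n + 1) * (L + 1) : ℕ) : ℝ) := by exact_mod_cast ht
      _ ≤ ((6 * (n + 1) * 2 ^ ℓ : ℕ) : ℝ) := by exact_mod_cast Nat.mul_le_mul_left _ hL
      _ = 6 * ((n : ℝ) + 1) * 2 ^ ℓ := by push_cast; ring
  have hB : (2 : ℝ) ≤ 2 ^ ℓ := by
    calc (2 : ℝ) = 2 ^ 1 := (pow_one _).symm
      _ ≤ 2 ^ ℓ := pow_le_pow_right₀ (by norm_num) hℓ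
  have h45 : (4 / 5 : ℝ) ^ n ≤ ((2 : ℝ) ^ ℓ)⁻¹ ^ 64 := by
    calc (4 / 5 : ℝ) ^ n ≤ (4 / 5 : ℝ) ^ (256 * ℓ) := pow_le_pow_of_le_one (by norm_num) (by norm_num) hn
      _ = ((4 / 5 : ℝ) ^ 4) ^ (64 * ℓ) := by rw [← pow_mul]; congr 1; ring
      _ ≤ ((1 / 2 : ℝ)) ^ (64 * ℓ) := pow_le_pow_left₀ (by norm_num) (by norm_num) _
      _ = ((2 : ℝ) ^ ℓ)⁻¹ ^ 64 := by rw [one_div, mul_comm, pow_mul, inv_pow]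
  have hsplit : (3 / 5 : ℝ) ^ n = (3 / 4 : ℝ) ^ n * (4 / 5 : ℝ) ^ n := by rw [← mul_pow]; norm_num
  have hpoly := pow_four_mul_pow_le n
  have hB0 : (0 : ℝ) < 2 ^ ℓ := by positivity
  set B : ℝ := 2 ^ ℓ with hBdef
  have ht4 : (t : ℝ) ^ 4 ≤ (6 * ((n : ℝ) + 1) * B) ^ 4 := pow_le_pow_left₀ (Nat.cast_nonneg t) ht' 4
  -- main chain
  have key : (512 : ℝ) * (t : ℝ) ^ 4 * (3 / 5 : ℝ) ^ n ≤ 512 * 1296 * 1000 * B ^ 4 * (B⁻¹ ^ 64) := by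
    calc (512 : ℝ) * (t : ℝ) ^ 4 * (3 / 5 : ℝ) ^ n ≤ 512 * (6 * ((n : ℝ) + 1) * B) ^ 4 * (3 / 5 : ℝ) ^ n := by
          gcongr
      _ = 512 * 1296 * B ^ 4 * ((((n : ℝ) + 1) ^ 4 * (3 / 4 : ℝ) ^ n) * (4 / 5 : ℝ) ^ n) := by rw [hsplit]; ring
      _ ≤ 512 * 1296 * B ^ 4 * (1000 * (B⁻¹ ^ 64)) := by gcongr
      _ = 512 * 1296 * 1000 * B ^ 4 * (B⁻¹ ^ 64) := by ring
  refine key.trans_lt ?_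
  have hB60 : (2 : ℝ) ^ 60 ≤ B ^ 60 := pow_le_pow_left₀ (by norm_num) hB 60
  have hBpos : (0 : ℝ) < B := hB0
  rw [inv_pow, show B ^ 64 = B ^ 4 * B ^ 60 by rw [← pow_add], mul_inv, ← mul_assoc,
    show (512 : ℝ) * 1296 * 1000 * B ^ 4 * (B ^ 4)⁻¹ = 512 * 1296 * 1000 by field_simp]
  rw [mul_inv_lt_iff₀ (by positivity), one_mul]
  calc (512 : ℝ) * 1296 * 1000 < 2 ^ 60 := by norm_num
    _ ≤ B ^ 60 := hB60

/-- **The kernel bound across distinct patches.**  With `φ_p(Λ_L) ≤ 3/5` and `ν = (3/5)^n`, `n = ⌊⌊(⌊s/2⌋−1)/(L+1)⌋/6⌋`: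
for `z` over `P` and `u` over `P′ ≠ P`, `τ_p(0, u − z) ≤ ν^{2‖P′−P‖₁}` — the sites are `≥ ⌊s/2⌋·max_j|P′_j − P_j|` apart
(`sub_not_mem_box_of_over`), the one-arm probability decays like `φ_p(Λ_L)^{⌊m/(L+1)⌋}`
(`real_siteToBoundary_le_phi_pow_div`), and `max ≥ sum/3`. [cite: DuminilCopinTassionEM2016, §2.1] -/
theorem kernel_bound {s L : ℕ} (hs : 2 ≤ s) (p : unitInterval) (hphi : DCT16.phi p (box 3 L) ≤ 3 / 5) :
    ∀ (P P' : ℤ × ℤ × ℤ) (z u : Site 3), P ≠ P' → ((IsPatchBase s z ∧ patchLabel s z = P) ∨ (IsPatchBase s (z - Pi.single 1 1) ∧ patchLabel s (z - Pi.single 1 1) = P)) →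
      ((IsPatchBase s u ∧ patchLabel s u = P') ∨ (IsPatchBase s (u - Pi.single 1 1) ∧ patchLabel s (u - Pi.single 1 1) = P')) →
      ENNReal.ofReal (tau 3 p 0 (u - z)) ≤
        ENNReal.ofReal ((3 / 5 : ℝ) ^ ((s / 2 - 1) / (L + 1) / 6)) ^ (2 * ((P'.1 - P.1).natAbs + (P'.2.1 - P.2.1).natAbs + (P'.2.2 - P.2.2).natAbs)) := by
  intro P P' z u hne hz hu
  set t := s / 2 with ht
  set a := (P'.1 - P.1).natAbs with ha
  set b := (P'.2.1 - P.2.1).natAbs with hb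
  set c := (P'.2.2 - P.2.2).natAbs with hc
  set M := max a (max b c) with hM
  have ht1 : 1 ≤ t := by omega
  have hM1 : 1 ≤ M := by
    by_contra h0
    push Not at h0
    have hM0 : M = 0 := by omega
    have : a = 0 ∧ b = 0 ∧ c = 0 := by
      refine ⟨?_, ?_, ?_⟩ <;> [have := le_max_left a (max b c);
        have := (le_max_left b c).trans (le_max_right a (max b c));
        have := (le_max_right b c).trans (le_max_right a (max b c))] <;> omega
    apply hne
    rw [ha, Int.natAbs_eq_zero, sub_eq_zero] at this
    rw [hb, Int.natAbs_eq_zero, sub_eq_zero] at this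
    rw [hc, Int.natAbs_eq_zero, sub_eq_zero] at this
    exact Prod.ext this.1.symm (Prod.ext this.2.1.symm this.2.2.symm)
  -- the separation
  have hbox : u - z ∉ box 3 (t * M - 1) := by
    refine sub_not_mem_box_of_over hs hz hu ?_
    have htM : ((t * M - 1 : ℕ) : ℤ) + 1 = (t : ℤ) * M := by
      have : 1 ≤ t * M := Nat.one_le_iff_ne_zero.2 (Nat.mul_ne_zero (by omega) (by omega))
      push_cast [Nat.cast_sub this]
      ring
    rw [htM]
    rcases max_choice a (max b c) with h1 | h1
    · left; rw [hM, h1, ha, Int.natCast_natAbs, ht]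
    · rcases max_choice b c with h2 | h2
      · right; left; rw [hM, h1, h2, hb, Int.natCast_natAbs, ht]
      · right; right; rw [hM, h1, h2, hc, Int.natCast_natAbs, ht]
  -- the one-arm decay
  have h1 : tau 3 p 0 (u - z) ≤ (3 / 5 : ℝ) ^ ((t * M - 1) / (L + 1)) := by
    refine (tau_le_real_siteToBoundary p hbox).trans ?_
    refine (DKT20.real_siteToBoundary_le_phi_pow_div p (by simp [mem_box]) (subset_refl (box 3 L)) _).trans ?_
    exact pow_le_pow_left₀ (DCT16.phi_nonneg p _) hphi _
  -- exponent bookkeeping: `(tM − 1)/(L+1) ≥ M ⌊(t−1)/(L+1)⌋ ≥ 2 (a+b+c) n`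
  have hexp : (t - 1) / (L + 1) / 6 * (2 * (a + b + c)) ≤ (t * M - 1) / (L + 1) := by
    have e1 : M * ((t - 1) / (L + 1)) ≤ (t * M - 1) / (L + 1) := by
      refine (Nat.mul_div_le_mul_div_assoc M (t - 1) (L + 1)).trans (Nat.div_le_div_right ?_)
      have : M * (t - 1) = t * M - M := by
        rw [Nat.mul_sub, mul_one, mul_comm]
      omega
    have e2 : a + b + c ≤ 3 * M := by
      have := le_max_left a (max b c)
      have := (le_max_left b c).trans (le_max_right a (max b c))
      have := (le_max_right b c).trans (le_max_right a (max b c))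
      omega
    have e3 : 6 * ((t - 1) / (L + 1) / 6) ≤ (t - 1) / (L + 1) := Nat.mul_div_le _ 6
    calc (t - 1) / (L + 1) / 6 * (2 * (a + b + c)) = 2 * (a + b + c) * ((t - 1) / (L + 1) / 6) := Nat.mul_comm _ _
      _ ≤ 2 * (3 * M) * ((t - 1) / (L + 1) / 6) := Nat.mul_le_mul_right _ (Nat.mul_le_mul_left 2 e2)
      _ = M * (6 * ((t - 1) / (L + 1) / 6)) := by ring
      _ ≤ M * ((t - 1) / (L + 1)) := Nat.mul_le_mul_left M e3
      _ ≤ (t * M - 1) / (L + 1) := e1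
  have h35 : (0 : ℝ) ≤ 3 / 5 := by norm_num
  have h2 : (3 / 5 : ℝ) ^ ((t * M - 1) / (L + 1)) ≤ ((3 / 5 : ℝ) ^ ((t - 1) / (L + 1) / 6)) ^ (2 * (a + b + c)) := by
    rw [← pow_mul]
    exact pow_le_pow_of_le_one h35 (by norm_num) hexp
  rw [← ENNReal.ofReal_pow (pow_nonneg h35 _)]
  exact ENNReal.ofReal_le_ofReal (h1.trans h2)

/-! ### The route statement -/

/-- **`PercLoopDislocationCovers.CoverSubcritTransfer` (stmt-CriticalPhenomena-13952).**  With `C₀ = 8192`: for `s ≥ 2`,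
`L ≥ 1`, `C₀ L (log₂ L + 1) ≤ s`, every `p < p_c(ℤ³)` satisfying the finite-size criterion `(2L+1)³ P_p(0 ↔ ∂Λ_L) ≤ 1/2`
has `θ_{G_s}(õ, p) = 0` on the loop-dislocated cover `G_s = dislocationLoopCover s` — Aizenman–Newman's cluster-of-clusters
expansion with the lifted patches as gadgets (`…Chains`, `…Sums`, `…SumsBranching`, `…Patches`, `…Bounds`), the links decaying by
the Duminil-Copin–Tassion iteration of the criterion, and `χ(p) < ∞` by sharpness.  Continuity-free.
[cite: AizenmanNewman1984, §4] [cite: DuminilCopinTassionEM2016, §2.1] [cite: LyonsPeres2016, Thm. 6.47] -/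
theorem coverSubcritTransfer_proof :
    Summit.CriticalPhenomena.PercolationContinuityZ3.Theses.PercLoopDislocationCovers.CoverSubcritTransfer := by
  refine ⟨8192, fun s L p hs hL hsL hp hcrit => ?_⟩
  -- the scales
  set t := s / 2 with ht
  set ℓ := Nat.log 2 L + 1 with hℓ
  set n := (t - 1) / (L + 1) / 6 with hn
  have hℓ1 : 1 ≤ ℓ := Nat.le_add_left 1 _
  have hLℓ : L + 1 ≤ 2 ^ ℓ := Nat.lt_pow_succ_log_self (by norm_num) L
  have ht0 : 4096 * L * ℓ ≤ t := by
    rw [ht, Nat.le_div_iff_mul_le two_pos]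
    calc 4096 * L * ℓ * 2 = 8192 * L * ℓ := by ring
      _ = 8192 * L * (Nat.log 2 L + 1) := by rw [hℓ]
      _ ≤ s := hsL
  have hn1 : 1536 * ℓ + 6 ≤ (t - 1) / (L + 1) := by
    rw [Nat.le_div_iff_mul_le (Nat.succ_pos L)]
    have h1 : (1536 * ℓ + 6) * (L + 1) + 1 ≤ 4096 * L * ℓ := by
      nlinarith [Nat.mul_le_mul_left ℓ hL, Nat.mul_le_mul_right L hℓ1]
    exact Nat.le_sub_of_add_le (h1.trans ht0)
  have hn256 : 256 * ℓ ≤ n := by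
    rw [hn, Nat.le_div_iff_mul_le (by norm_num)]
    linarith
  have htn : t ≤ 6 * (n + 1) * (L + 1) := by
    have h1 : t - 1 < ((t - 1) / (L + 1) + 1) * (L + 1) := by
      have := Nat.lt_div_mul_add (a := t - 1) (Nat.succ_pos L)
      linarith
    have h2 : (t - 1) / (L + 1) < (n + 1) * 6 := by
      have := Nat.lt_div_mul_add (a := (t - 1) / (L + 1)) (show 0 < 6 by norm_num)
      rw [hn]; linarith
    have h3 : (t - 1) / (L + 1) + 1 ≤ 6 * (n + 1) := by have := Nat.succ_le_of_lt h2; linarith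
    have h4 : t ≤ ((t - 1) / (L + 1) + 1) * (L + 1) := Nat.le_of_pred_lt h1
    exact h4.trans (Nat.mul_le_mul_right _ h3)
  -- the ingredients
  have hphi : DCT16.phi p (box 3 L) ≤ 3 / 5 := phi_box_le p hL hcrit
  have hnum : (512 : ℝ) * (t : ℝ) ^ 4 * (3 / 5 : ℝ) ^ n < 1 := numeric_bound htn hLℓ hn256 hℓ1
  have h35 : (0 : ℝ) ≤ (3 / 5 : ℝ) ^ n := by positivity
  have hν : ENNReal.ofReal ((3 / 5 : ℝ) ^ n) ≤ 2⁻¹ := by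
    have h2 : 2 ≤ n := le_trans (by norm_num) (le_trans (Nat.mul_le_mul_left 256 hℓ1) hn256)
    calc ENNReal.ofReal ((3 / 5 : ℝ) ^ n) ≤ ENNReal.ofReal ((3 / 5 : ℝ) ^ 2) :=
          ENNReal.ofReal_le_ofReal (pow_le_pow_of_le_one (by norm_num) (by norm_num) h2)
      _ ≤ ENNReal.ofReal (2⁻¹ : ℝ) := ENNReal.ofReal_le_ofReal (by norm_num)
      _ = 2⁻¹ := by rw [ENNReal.ofReal_inv_of_pos two_pos, ENNReal.ofReal_ofNat]
  have hχ : ∑' v : Site 3, ENNReal.ofReal (tau 3 p 0 v) ≠ ∞ := by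
    rw [← ENNReal.ofReal_tsum_of_nonneg (fun v => tau_nonneg _ _ _) (summable_tau_of_lt_criticalProb (by norm_num) p hp)]
    exact ENNReal.ofReal_ne_top
  have hm : 128 * (2 * ((s / 2 : ℕ) : ℝ≥0∞) ^ 2) ^ 2 * ENNReal.ofReal ((3 / 5 : ℝ) ^ n) < 1 := by
    have h1 : 128 * (2 * ((s / 2 : ℕ) : ℝ≥0∞) ^ 2) ^ 2 * ENNReal.ofReal ((3 / 5 : ℝ) ^ n) =
        ENNReal.ofReal (512 * (t : ℝ) ^ 4 * (3 / 5 : ℝ) ^ n) := by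
      rw [ENNReal.ofReal_mul (by positivity), ENNReal.ofReal_mul (by norm_num), ENNReal.ofReal_ofNat,
        ENNReal.ofReal_pow (Nat.cast_nonneg _), ENNReal.ofReal_natCast, ht]
      ring
    rw [h1]
    exact ENNReal.ofReal_lt_one.2 hnum
  exact theta_eq_zero_of_kernel_bound hs p (kernel_bound hs p hphi) hν hχ hm

end CoverSubcritTransfer

end Summit.CriticalPhenomena.PercolationContinuityZ3.Theorems

end
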